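import Summits.RiemannHypothesis.RiemannHypothesis.Theorems.SoloInformedNonDegenerate
import Literature.NumberTheory.LFunctions.PrimeReciprocalWindows
import HarnessLib

/-!
# Low-frequency tests obey a double-exponential lower law under RH (solo-informed T65)

Write `Q(g) = weilQuadratic g` for Weil's form and `ĝ = weilMellin g`. The upper size law of the
tree (`weilGroundEnergy a ≤ exp(−c·a·e^{2a})`, Connes's prolate tests) is DOUBLE-exponential in
the window `a`, and its near-minimisers carry their spectral bulk at height `≍ e^{2a}`. Here the
matching LOWER law is proved, under RH, for every test that is not small at some point of
bounded height:

* `weilQuadratic_re_ge_exp_neg_of_large_value` — under RH there are `C₁, C₂ > 0` such that for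
  all `a ≥ 1`, every normalised smooth `g` with `tsupport g ⊆ [-a, a]`, every `w ≥ e^{C₁ a}` and
  every `|t₀| ≤ w` with `|ĝ(½ + it₀)| ≥ e^{−aw}`:
  `Re Q(g) ≥ exp(−C₂ · a · w · log w)`.
  With `w = max(T, e^{C₁a})` this is `exp(−e^{O(a)})` for tests whose spectral bulk sits below a
  height `T = e^{O(a)}` — the double-exponential shape of the upper law — and it degrades to
  triple-exponential only through `w ≥ T` when the bulk may sit as high as the spectral ceiling
  `exp(O(a e^{a}))` allows.

Proof: one application of the node bound of T62 (`norm_weilMellin_le_of_nodes`) at `t₀` with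
Selberg's block `[w, 2w]` (`Radziwill2012_lemma5_holds`: `≥ c₀ w log w` critical ordinates,
pairwise `≥ 2πA/log w` apart), radius `2w + (w + 1)`, and a sub-block of exactly
`N = ⌈15aw/log 2⌉` nodes: the growth term `e^{3(3w+1)a}√(2a)/2^N` is `≤ e^{−aw}/2`
(`nodes_growth_term_le`), and the sampling term `2Nδ(4(3w+1)log w/(2πA))^{N−1}` is
`< e^{−aw}/2` once `δ² = exp(−C₂ a w log w)` (`nodes_sampling_term_lt`). The only coupling to the
height of `t₀` is Selberg's WINDOW LENGTH: nodes near `t₀` come from a block of length `≍ w ≥ |t₀|`.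

References: A. Selberg (1942) via M. Radziwiłł, arXiv:1207.6583 Lemma 5 (key `Radziwill2012`);
E. Bombieri, Rend. Mat. Acc. Lincei (9) 11 (2000) §4 (key `Bombieri2000Weil`); A. Connes,
arXiv:2602.04022 (2026) §6 for the upper law (key `Connes2026`). The statement is new. [new]
-/

noncomputable section

open Complex Set MeasureTheory
open Literature.NumberTheory.LFunctions Literature.Barriers.RiemannHypothesis
open scoped Real

namespace Summit.RiemannHypothesis.RiemannHypothesis.Theorems

/-- `√(2a) ≤ e^{a}`. [folklore] -/
theorem sqrt_two_mul_le_exp (a : ℝ) : Real.sqrt (2 * a) ≤ Real.exp a := by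
  have h1 : 2 * a ≤ Real.exp a ^ 2 := by
    have := Real.add_one_le_exp a
    nlinarith [Real.exp_pos a, sq_nonneg (a - 1)]
  calc Real.sqrt (2 * a) ≤ Real.sqrt (Real.exp a ^ 2) := Real.sqrt_le_sqrt h1
    _ = Real.exp a := Real.sqrt_sq (Real.exp_pos a).le

/-- **The growth term.** For `a, w ≥ 1`, `m ≥ e^{−aw}` and `N log 2 ≥ 15aw`:
`e^{3(2w+(w+1))a} √(2a) / 2^N ≤ m/2`. [new] -/
theorem nodes_growth_term_le {a w m : ℝ} (ha : 1 ≤ a) (hw : 1 ≤ w)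
    (hm : Real.exp (-(a * w)) ≤ m) {N : ℕ} (hN : 15 * a * w ≤ N * Real.log 2) :
    Real.exp (3 * (2 * w + (w + 1)) * a) * Real.sqrt (2 * a) / 2 ^ N ≤ m / 2 := by
  have haw : 1 ≤ a * w := by nlinarith
  have h2N : Real.exp (15 * a * w) ≤ (2 : ℝ) ^ N := by
    rw [PrimeReciprocal.two_pow_eq_exp]
    exact Real.exp_le_exp.2 hN
  have hnum : Real.exp (3 * (2 * w + (w + 1)) * a) * Real.sqrt (2 * a) ≤
      Real.exp (13 * a * w) := by
    calc Real.exp (3 * (2 * w + (w + 1)) * a) * Real.sqrt (2 * a)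
        ≤ Real.exp (12 * a * w) * Real.exp a :=
          mul_le_mul (Real.exp_le_exp.2 (by nlinarith)) (sqrt_two_mul_le_exp a)
            (Real.sqrt_nonneg _) (Real.exp_pos _).le
      _ = Real.exp (12 * a * w + a) := (Real.exp_add _ _).symm
      _ ≤ Real.exp (13 * a * w) := Real.exp_le_exp.2 (by nlinarith)
  have hpow : (0 : ℝ) < 2 ^ N := by positivity
  rw [div_le_iff₀ hpow]
  -- `exp(13aw) ≤ (m/2) 2^N` since `(m/2) 2^N ≥ (e^{-aw}/2) e^{15aw} = e^{14aw}/2 ≥ e^{13aw}`.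
  have he : 2 ≤ Real.exp (a * w) := by
    have := Real.add_one_le_exp (a * w)
    linarith
  have h14 : Real.exp (14 * a * w) = Real.exp (13 * a * w) * Real.exp (a * w) := by
    rw [← Real.exp_add]; ring_nf
  have h15 : Real.exp (15 * a * w) = Real.exp (14 * a * w) * Real.exp (a * w) := by
    rw [← Real.exp_add]; ring_nf
  have hm0 : 0 ≤ m := le_trans (Real.exp_pos _).le hm
  have hexpaw : Real.exp (-(a * w)) * Real.exp (a * w) = 1 := by
    rw [← Real.exp_add]; simp
  calc Real.exp (3 * (2 * w + (w + 1)) * a) * Real.sqrt (2 * a)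
      ≤ Real.exp (13 * a * w) := hnum
    _ ≤ Real.exp (13 * a * w) * Real.exp (a * w) / 2 := by
        have h0 := Real.exp_pos (13 * a * w)
        nlinarith
    _ = Real.exp (-(a * w)) / 2 * Real.exp (15 * a * w) := by
        rw [h15, h14]
        have : Real.exp (-(a * w)) / 2 * (Real.exp (13 * a * w) * Real.exp (a * w) *
            Real.exp (a * w)) = Real.exp (13 * a * w) * Real.exp (a * w) / 2 *
            (Real.exp (-(a * w)) * Real.exp (a * w)) := by ring
        rw [this, hexpaw, mul_one]
    _ ≤ m / 2 * 2 ^ N := by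
        have h1 : Real.exp (-(a * w)) / 2 ≤ m / 2 := by linarith
        exact mul_le_mul h1 h2N (Real.exp_pos _).le (by linarith)

/-- **The sampling term.** For `a ≥ 1`, `log w ≥ 1`, `A > 0`, `1 ≤ N ≤ 24aw` and
`w ≥ 1`, `0 ≤ δ ≤ exp(−(28 + 24(L+2)) a w log w)` with `L = log(16/(2πA) + 1)`:
`4 N δ (4(2w+(w+1))/(2πA/log w))^{N−1} < e^{−aw}`. [new] -/
theorem nodes_sampling_term_lt {a w A δ : ℝ} (ha : 1 ≤ a) (hw1 : 1 ≤ w) (hw : 1 ≤ Real.log w)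
    (hA : 0 < A) (hδ0 : 0 ≤ δ)
    (hδ : δ ≤ Real.exp (-((28 + 24 * (Real.log (16 / (2 * π * A) + 1) + 2)) *
      a * w * Real.log w))) {N : ℕ} (hN1 : 1 ≤ N) (hN : (N : ℝ) ≤ 24 * a * w) :
    4 * N * δ * (4 * (2 * w + (w + 1)) / (2 * π * A / Real.log w)) ^ (N - 1) <
      Real.exp (-(a * w)) := by
  have hwpos : 0 < w := by linarith
  have haw : 1 ≤ a * w := by nlinarith
  obtain ⟨K, hK⟩ : ∃ K : ℝ, K = 16 / (2 * π * A) := ⟨_, rfl⟩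
  have hK0 : 0 < K := by rw [hK]; positivity
  obtain ⟨L, hL⟩ : ∃ L : ℝ, L = Real.log (K + 1) := ⟨_, rfl⟩
  have hL0 : 0 ≤ L := by rw [hL]; exact Real.log_nonneg (by linarith)
  obtain ⟨C, hC⟩ : ∃ C : ℝ, C = 28 + 24 * (L + 2) := ⟨_, rfl⟩
  have hδC : δ ≤ Real.exp (-(C * a * w * Real.log w)) := by rw [hC, hL, hK]; exact hδ
  -- the base `B ≤ (K + 1) w²`
  obtain ⟨B, hB⟩ : ∃ B : ℝ, B = 4 * (2 * w + (w + 1)) / (2 * π * A / Real.log w) := ⟨_, rfl⟩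
  have hBe : B = K * ((3 * w + 1) / 4) * Real.log w := by
    rw [hB, hK]
    field_simp
    ring
  have hlogw_le : Real.log w ≤ w := (Real.log_le_sub_one_of_pos hwpos).trans (by linarith)
  have hB0 : 0 ≤ B := by rw [hBe]; positivity
  obtain ⟨B', hB'⟩ : ∃ B' : ℝ, B' = (K + 1) * w ^ 2 := ⟨_, rfl⟩
  have hBB' : B ≤ B' := by
    rw [hBe, hB']
    have h1 : (3 * w + 1) / 4 ≤ w := by linarith
    have h2 : (3 * w + 1) / 4 * Real.log w ≤ w * w :=
      mul_le_mul h1 hlogw_le (by linarith) (by linarith)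
    calc K * ((3 * w + 1) / 4) * Real.log w = K * ((3 * w + 1) / 4 * Real.log w) := by ring
      _ ≤ K * (w * w) := mul_le_mul_of_nonneg_left h2 hK0.le
      _ ≤ (K + 1) * w ^ 2 := by nlinarith [sq_nonneg w]
  have hB'1 : 1 ≤ B' := by
    rw [hB']
    have : (1 : ℝ) ≤ w ^ 2 := by nlinarith
    nlinarith
  have hB'pos : 0 < B' := by linarith
  -- `B^{N-1} ≤ B'^{N} = exp(N log B') ≤ exp(N (L + 2) log w)`
  have hlogB' : Real.log B' ≤ (L + 2) * Real.log w := by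
    rw [hB', Real.log_mul (by linarith) (by positivity), Real.log_pow, hL]
    have h0 := Real.log_nonneg (show (1 : ℝ) ≤ K + 1 by linarith)
    have h1 : Real.log (K + 1) ≤ Real.log (K + 1) * Real.log w := by nlinarith
    push_cast
    linarith
  have hX : B ^ (N - 1) ≤ Real.exp (N * ((L + 2) * Real.log w)) := by
    calc B ^ (N - 1) ≤ B' ^ (N - 1) := pow_le_pow_left₀ hB0 hBB' _
      _ ≤ B' ^ N := pow_le_pow_right₀ hB'1 (Nat.sub_le N 1)
      _ = Real.exp (N * Real.log B') := by
          rw [← Real.rpow_natCast, Real.rpow_def_of_pos hB'pos, mul_comm]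
      _ ≤ Real.exp (N * ((L + 2) * Real.log w)) :=
          Real.exp_le_exp.2 (mul_le_mul_of_nonneg_left hlogB' (by positivity))
  -- `4 ≤ exp 2`, `N ≤ exp N`
  have h4 : (4 : ℝ) ≤ Real.exp 2 := by
    have := Real.add_one_le_exp (1 : ℝ)
    have h : Real.exp 2 = Real.exp 1 * Real.exp 1 := by rw [← Real.exp_add]; norm_num
    rw [h]; nlinarith [Real.exp_pos (1 : ℝ)]
  have hNexp : (N : ℝ) ≤ Real.exp N := by
    have := Real.add_one_le_exp (N : ℝ)
    linarith
  have hN0 : (0 : ℝ) < N := by exact_mod_cast hN1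
  -- assemble: `≤ exp(2 + N + N(L+2)log w − C a w log w) ≤ exp(−2aw) < exp(−aw)`
  have hprod : 4 * N * δ * B ^ (N - 1) ≤
      Real.exp (2 + N + N * ((L + 2) * Real.log w) - C * a * w * Real.log w) := by
    have e : Real.exp (2 + N + N * ((L + 2) * Real.log w) - C * a * w * Real.log w) =
        Real.exp 2 * Real.exp N * Real.exp (-(C * a * w * Real.log w)) *
          Real.exp (N * ((L + 2) * Real.log w)) := by
      rw [← Real.exp_add, ← Real.exp_add, ← Real.exp_add]; ring_nf
    rw [e]
    exact mul_le_mul (mul_le_mul (mul_le_mul h4 hNexp hN0.le (Real.exp_pos _).le) hδC hδ0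
      (by positivity)) hX (pow_nonneg hB0 _) (by positivity)
  have hexp : 2 + N + N * ((L + 2) * Real.log w) - C * a * w * Real.log w ≤ -(2 * (a * w)) := by
    have hawl' : a * w ≤ a * w * Real.log w := by nlinarith
    have hawl : 1 ≤ a * w * Real.log w := le_trans haw hawl'
    have h2 : (N : ℝ) ≤ 24 * (a * w * Real.log w) := by linarith
    have h3 : N * ((L + 2) * Real.log w) ≤ 24 * (L + 2) * (a * w * Real.log w) := by
      have := mul_le_mul_of_nonneg_right hN
        (mul_nonneg (by linarith) (by linarith) : (0 : ℝ) ≤ (L + 2) * Real.log w)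
      linarith
    have h4' : 2 * (a * w) ≤ 2 * (a * w * Real.log w) := by linarith
    rw [hC]
    linarith
  rw [← hB]
  calc 4 * N * δ * B ^ (N - 1)
      ≤ Real.exp (2 + N + N * ((L + 2) * Real.log w) - C * a * w * Real.log w) := hprod
    _ ≤ Real.exp (-(2 * (a * w))) := Real.exp_le_exp.2 hexp
    _ < Real.exp (-(a * w)) := Real.exp_lt_exp.2 (by linarith)

/-- **Low-frequency tests obey a double-exponential lower law under RH.** There are `C₁, C₂ > 0`
such that, under RH, for all `a ≥ 1`, every smooth `g` with `tsupport g ⊆ [-a, a]` and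
`‖g‖₂ = 1`, every `w ≥ e^{C₁ a}` and every `|t₀| ≤ w` at which `|ĝ(½ + it₀)| ≥ e^{−aw}`:
`Re Q(g) ≥ exp(−C₂ · a · w · log w)`. (Selberg's separated critical zeros in `[w, 2w]` as
sampling nodes; T62's node bound at `t₀`.) [new] -/
theorem weilQuadratic_re_ge_exp_neg_of_large_value (hRH : RiemannHypothesis) :
    ∃ C₁ C₂ : ℝ, 0 < C₁ ∧ 0 < C₂ ∧ ∀ a : ℝ, 1 ≤ a → ∀ g : ℝ → ℂ, IsWeilTest g →
      tsupport g ⊆ Icc (-a) a → ∫ t, ‖g t‖ ^ 2 = (1 : ℝ) →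
      ∀ w t₀ : ℝ, Real.exp (C₁ * a) ≤ w → |t₀| ≤ w →
        Real.exp (-(a * w)) ≤ ‖weilMellin g (1 / 2 + t₀ * I)‖ →
        Real.exp (-(C₂ * a * w * Real.log w)) ≤ (weilQuadratic g).re := by
  classical
  obtain ⟨A, hA, c₀, hc₀, T₀, hnodes⟩ := Radziwill2012_lemma5_holds
  obtain ⟨L, hL⟩ : ∃ L : ℝ, L = Real.log (16 / (2 * π * A) + 1) := ⟨_, rfl⟩
  have hL0 : 0 ≤ L := by
    rw [hL]
    exact Real.log_nonneg (le_add_of_nonneg_left (by positivity))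
  obtain ⟨C, hC⟩ : ∃ C : ℝ, C = 28 + 24 * (L + 2) := ⟨_, rfl⟩
  have hC0 : 0 < C := by rw [hC]; positivity
  obtain ⟨C₁, hC₁⟩ : ∃ C₁ : ℝ, C₁ = max (24 / c₀ + 1) (|T₀| + 1) := ⟨_, rfl⟩
  have hC₁1 : 1 ≤ C₁ := by
    rw [hC₁]; exact le_trans (by linarith [abs_nonneg T₀]) (le_max_right _ _)
  refine ⟨C₁, 2 * C, by linarith, by positivity, ?_⟩
  intro a ha g hg hsupp hnorm w t₀ hw ht₀ hm
  have ha0 : 0 < a := by linarith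
  -- size of `w`
  have hlogw : C₁ * a ≤ Real.log w := by
    rw [Real.le_log_iff_exp_le (lt_of_lt_of_le (Real.exp_pos _) hw)]
    exact hw
  have hlogw1 : 1 ≤ Real.log w := le_trans (by nlinarith) hlogw
  have hwC₁ : C₁ + 1 ≤ w := by
    have := Real.add_one_le_exp (C₁ * a)
    nlinarith
  have hw1 : 1 ≤ w := by linarith
  have hwT₀ : T₀ ≤ w := by
    have : |T₀| + 1 ≤ C₁ := by rw [hC₁]; exact le_max_right _ _
    linarith [le_abs_self T₀]
  have haw : 1 ≤ a * w := by nlinarith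
  -- Selberg's nodes in `[w, 2w]`, and a sub-block of exactly `N` of them
  obtain ⟨S, hS, hsep, hcard⟩ := hnodes w hwT₀
  obtain ⟨N, hN⟩ : ∃ N : ℕ, N = ⌈15 * a * w / Real.log 2⌉₊ := ⟨_, rfl⟩
  have hlog2 : 0 < Real.log 2 := Real.log_pos one_lt_two
  have hNlog : 15 * a * w ≤ N * Real.log 2 := by
    have h := Nat.le_ceil (15 * a * w / Real.log 2)
    rw [← hN] at h
    rwa [div_le_iff₀ hlog2] at h
  have hN24 : (N : ℝ) ≤ 24 * a * w := by
    have h := Nat.ceil_lt_add_one (show 0 ≤ 15 * a * w / Real.log 2 by positivity)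
    rw [← hN] at h
    have hl : 15 * a * w / Real.log 2 ≤ 22 * a * w := by
      rw [div_le_iff₀ hlog2]
      have := Real.log_two_gt_d9
      nlinarith
    linarith
  have hN1 : 1 ≤ N := by
    have h15 : 0 < 15 * a * w := by positivity
    have h' : (0 : ℝ) < N * Real.log 2 := lt_of_lt_of_le h15 hNlog
    have h : (0 : ℝ) < N := by
      by_contra hN0
      push Not at hN0
      have : (N : ℝ) * Real.log 2 ≤ 0 := mul_nonpos_of_nonpos_of_nonneg hN0 hlog2.le
      linarith
    exact_mod_cast h
  have hNS : N ≤ S.card := by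
    have h24 : 24 / c₀ + 1 ≤ C₁ := by rw [hC₁]; exact le_max_left _ _
    have h2 : (24 / c₀ + 1) * a ≤ Real.log w := le_trans (by nlinarith) hlogw
    have h3 : 24 * a ≤ c₀ * Real.log w := by
      have h5 : 24 / c₀ * a ≤ Real.log w := by
        nlinarith [div_pos (by norm_num : (0:ℝ) < 24) hc₀]
      have h6 := mul_le_mul_of_nonneg_left h5 hc₀.le
      have e : c₀ * (24 / c₀ * a) = 24 * a := by field_simp
      linarith
    have h4 : (N : ℝ) ≤ S.card := by
      calc (N : ℝ) ≤ 24 * a * w := hN24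
        _ ≤ c₀ * Real.log w * w := by nlinarith
        _ = c₀ * w * Real.log w := by ring
        _ ≤ S.card := hcard
    exact_mod_cast h4
  obtain ⟨S', hS'S, hS'card⟩ := Finset.exists_subset_card_eq hNS
  have hS' : ∀ γ ∈ S', γ ∈ Icc w (2 * w) ∧ riemannZeta (1 / 2 + γ * I) = 0 :=
    fun γ hγ ↦ hS γ (hS'S hγ)
  have hsep' : ∀ γ ∈ S', ∀ γ' ∈ S', γ ≠ γ' → 2 * π * A / Real.log w ≤ |γ - γ'| :=
    fun γ hγ γ' hγ' hne ↦ hsep γ (hS'S hγ) γ' (hS'S hγ') hne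
  -- suppose the form is smaller than `δ² = exp(−2C a w log w)`
  by_contra hQ
  push Not at hQ
  obtain ⟨δ, hδ⟩ : ∃ δ : ℝ, δ = Real.exp (-(C * a * w * Real.log w)) := ⟨_, rfl⟩
  have hδ0 : 0 < δ := by rw [hδ]; exact Real.exp_pos _
  have hδsq : δ ^ 2 = Real.exp (-(2 * C * a * w * Real.log w)) := by
    rw [hδ, sq, ← Real.exp_add]; ring_nf
  have hQδ : (weilQuadratic g).re < δ ^ 2 := by rw [hδsq]; exact hQ
  have hH : 0 < w + 1 := by linarith
  have ht₀' : |t₀| < w + 1 := by linarith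
  have hnode := norm_weilMellin_le_of_nodes hRH hg ha0 hsupp hnorm hw1 (by linarith) hA hH
    ht₀' hδ0 S' hS' hsep' hQδ
  rw [hS'card] at hnode
  have hfirst := nodes_growth_term_le ha hw1 (le_refl (Real.exp (-(a * w)))) hNlog
  have hδle : δ ≤ Real.exp (-((28 + 24 * (Real.log (16 / (2 * π * A) + 1) + 2)) * a * w *
      Real.log w)) := by rw [hδ, hC, hL]
  have hsecond := nodes_sampling_term_lt ha hw1 hlogw1 hA hδ0.le hδle hN1 hN24
  have h1 : Real.exp (-(a * w)) ≤ Real.exp (-(a * w)) / 2 +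
      2 * N * δ * (4 * (2 * w + (w + 1)) / (2 * π * A / Real.log w)) ^ (N - 1) :=
    hm.trans (hnode.trans (by linarith))
  linarith

end Summit.RiemannHypothesis.RiemannHypothesis.Theorems
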